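import Literature.NumberTheory.Irrationality.Zudilin2014.SecondTale
import Summits.KontsevichZagierPeriods.Zeta5Search.TwoTaleP15Residue

/-!
# The two-tale point P15: the second-tale partner and Lemma 8 for `q̂` in the kernel

HONEST FRAMING: systematic search; no irrationality claim unless certified.

Cell pub-zeta5, T3 service (fam-measure / fam-denom D16).  The Remark-5 partner of P15 [Zudilin2014ZetaTwo, Remark 5]:
`â = (32n+2; 11n+1, 13n+1, 15n+1)`, `b̂ = (15n+2; 6n+1, 24n+2, 26n+2)` (`families/measure/FAMILY.md` §2.5).
With `Literature/…/Zudilin2014/SecondTale.lean` (Prop. 3 forms, eq. (T2), Lemma 8 for `q̂` termwise) this file gives: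

* `aT n`, `bT n`, `admissibleT`; `qhatP15 n = q̂(â,b̂)` (the integer `formQTZ`), `qhatP15_cast`;
* `digit_rule` — Lemma 8's count at the partner in residues: with `r = n mod p`, `s = (k−1) mod p`,
  `E(k) = ⌊(2s−15r)/p⌋ − ⌊(2s−32r)/p⌋ − ⌊17r/p⌋ + ⌊(s−6r)/p⌋ − ⌊(s−11r)/p⌋ − ⌊5r/p⌋ + ⌊11r/p⌋ − ⌊(s−13r)/p⌋
   − ⌊(24r−s)/p⌋ + ⌊11r/p⌋ − ⌊(s−15r)/p⌋ − ⌊(26r−s)/p⌋` (Zudilin's `φ̂ = min_y`, eq. before (T-ar), `x = r/p`,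
  `y = s/p`), read off from the twelve digit bounds;
* the five SECOND-TALE INTERVALS of fam-denom's table: `{n/p} ∈ [1/11, 2/17)` (`ivl 9`), `[5/11, 7/15)` (`ivl 14`),
  `[6/11, 9/16)` (`ivl 15`), `[10/11, 14/15)` (`ivl 19`) at level 2 and `[3/13, 4/17) ⊂ ivl 1` at level 1:
  `p^level ∣ qhatP15 n` for every prime with `26n < p²` — theorems `qhat_ivl_9/14/15/19/1_right`, each a
  machine-generated decision tree over the digits (≤ 34 leaves; infeasible leaves closed by `omega`) —
  witness trees: HOME `code/p1/g9/p15_tale2_tree.py` / `p15_tale2_trees.json`.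
With the two-tale coincidence `(bmiss)`@P15 (`q_n = −q̂_n`; Whipple / the cell's certificates) these give
`p^level ∣ q_n` on those intervals; the companion statement for `D₁₅ₙD₁₆ₙ p_n` needs Lemma 8 for `B_k`/`p̂` (not here).
-/

noncomputable section

namespace Summit.KontsevichZagierPeriods.Zeta5Search.TwoTaleP15

open Finset
open Literature.NumberTheory.Irrationality.Zudilin2014

/-! ### The partner point -/

/-- `â = (32n+2; 11n+1, 13n+1, 15n+1)`. -/
def aT (n : ℕ) : Fin 4 → ℤ := ![32 * (n : ℤ) + 2, 11 * (n : ℤ) + 1, 13 * (n : ℤ) + 1, 15 * (n : ℤ) + 1]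

/-- `b̂ = (15n+2; 6n+1, 24n+2, 26n+2)`. -/
def bT (n : ℕ) : Fin 4 → ℤ := ![15 * (n : ℤ) + 2, 6 * (n : ℤ) + 1, 24 * (n : ℤ) + 2, 26 * (n : ℤ) + 2]

/-- Evaluation lemma `aT_zero` (component of the parameter vector). -/
@[simp] theorem aT_zero (n : ℕ) : aT n 0 = 32 * (n : ℤ) + 2 := rfl
/-- Evaluation lemma `aT_one` (component of the parameter vector). -/
@[simp] theorem aT_one (n : ℕ) : aT n 1 = 11 * (n : ℤ) + 1 := rfl
/-- Evaluation lemma `aT_two` (component of the parameter vector). -/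
@[simp] theorem aT_two (n : ℕ) : aT n 2 = 13 * (n : ℤ) + 1 := rfl
/-- Evaluation lemma `aT_three` (component of the parameter vector). -/
@[simp] theorem aT_three (n : ℕ) : aT n 3 = 15 * (n : ℤ) + 1 := rfl
/-- Evaluation lemma `bT_zero` (component of the parameter vector). -/
@[simp] theorem bT_zero (n : ℕ) : bT n 0 = 15 * (n : ℤ) + 2 := rfl
/-- Evaluation lemma `bT_one` (component of the parameter vector). -/
@[simp] theorem bT_one (n : ℕ) : bT n 1 = 6 * (n : ℤ) + 1 := rfl
/-- Evaluation lemma `bT_two` (component of the parameter vector). -/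
@[simp] theorem bT_two (n : ℕ) : bT n 2 = 24 * (n : ℤ) + 2 := rfl
/-- Evaluation lemma `bT_three` (component of the parameter vector). -/
@[simp] theorem bT_three (n : ℕ) : bT n 3 = 26 * (n : ℤ) + 2 := rfl

/-- The partner is admissible (eq. (cond2)) for `n ≥ 1`. -/
theorem admissibleT {n : ℕ} (hn : 1 ≤ n) : AdmissibleT (aT n) (bT n) where
  b0_le_a0 := by simp; omega
  b0_le j hj := by fin_cases j <;> simp at hj ⊢ <;> omega
  b1_le_a0 := by simp; omega
  b1_le j hj := by fin_cases j <;> simp at hj ⊢ <;> omega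
  a0_lt := by simp; omega
  a_lt j hj := by fin_cases j <;> simp at hj ⊢ <;> omega
  balance := by simp [Fin.sum_univ_four]; ring

/-- `â₃* = 15n+1`, `b̂₂* = 24n+2`. -/
theorem range_eq (n : ℕ) : aMax3 (aT n) = 15 * (n : ℤ) + 1 ∧ bMin (bT n) = 24 * (n : ℤ) + 2 := by
  constructor
  · unfold aMax3; simp; omega
  · unfold bMin; simp; omega

/-- **`q̂_n` at the partner** (an integer): `q̂(â,b̂)` of Proposition 3. -/
def qhatP15 (n : ℕ) : ℤ := formQTZ (aT n) (bT n)

/-- `qhatP15 n = q̂(â,b̂)`. -/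
theorem qhatP15_cast {n : ℕ} (hn : 1 ≤ n) : (qhatP15 n : ℚ) = formQT (aT n) (bT n) :=
  (formQT_eq_cast (admissibleT hn)).symm

/-! ### The digit rule (Lemma 8 at the partner) -/

/-- **The digit rule** (Zudilin 2014 Lemma 8 / eq. (T3a) at the partner of P15, for `k` in the `q̂`-range with
`2k ≥ â₀`, i.e. `16n+1 ≤ k ≤ 24n+1`): with `r = n mod p`, `s = (k−1) mod p` and the twelve floor digits
`j₀ = ⌊(2s−15r)/p⌋, j₁ = ⌊(2s−32r)/p⌋, j₂ = ⌊17r/p⌋, j₃ = ⌊(s−6r)/p⌋, j₄ = ⌊(s−11r)/p⌋, j₅ = ⌊5r/p⌋, j₆ = ⌊11r/p⌋,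
j₇ = ⌊(s−13r)/p⌋, j₈ = ⌊(24r−s)/p⌋, j₉ = ⌊11r/p⌋, j₁₀ = ⌊(s−15r)/p⌋, j₁₁ = ⌊(26r−s)/p⌋`,
`digitAT = (j₀−j₁−j₂) + (j₃−j₄−j₅) + (j₆−j₇−j₈) + (j₉−j₁₀−j₁₁)`. -/
theorem digit_rule {n p : ℕ} (hp : 0 < p) {k : ℤ} (hk : 16 * (n : ℤ) + 1 ≤ k) (hk' : k ≤ 24 * (n : ℤ) + 1)
    (r s : ℤ) (hr : r = (n : ℤ) % p) (hs : s = (k - 1) % p) (j0 j1 j2 j3 j4 j5 j6 j7 j8 j10 j11 : ℤ)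
    (h0 : j0 * p ≤ 2 * s - 15 * r ∧ 2 * s - 15 * r < (j0 + 1) * p)
    (h1 : j1 * p ≤ 2 * s - 32 * r ∧ 2 * s - 32 * r < (j1 + 1) * p)
    (h2 : j2 * p ≤ 17 * r ∧ 17 * r < (j2 + 1) * p)
    (h3 : j3 * p ≤ s - 6 * r ∧ s - 6 * r < (j3 + 1) * p)
    (h4 : j4 * p ≤ s - 11 * r ∧ s - 11 * r < (j4 + 1) * p)
    (h5 : j5 * p ≤ 5 * r ∧ 5 * r < (j5 + 1) * p)
    (h6 : j6 * p ≤ 11 * r ∧ 11 * r < (j6 + 1) * p)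
    (h7 : j7 * p ≤ s - 13 * r ∧ s - 13 * r < (j7 + 1) * p)
    (h8 : j8 * p ≤ 24 * r - s ∧ 24 * r - s < (j8 + 1) * p)
    (h10 : j10 * p ≤ s - 15 * r ∧ s - 15 * r < (j10 + 1) * p)
    (h11 : j11 * p ≤ 26 * r - s ∧ 26 * r - s < (j11 + 1) * p) :
    (digitAT p (aT n) (bT n) k : ℤ) =
      (j0 - j1 - j2) + (j3 - j4 - j5) + (j6 - j7 - j8) + (j6 - j10 - j11) := by
  have hp' : (0 : ℤ) < p := by exact_mod_cast hp
  set N : ℤ := (n : ℤ) / p with hN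
  set K : ℤ := (k - 1) / p with hK
  have hn : (n : ℤ) = p * N + r := by rw [hr, hN]; exact (Int.mul_ediv_add_emod _ _).symm
  have hk1 : k - 1 = p * K + s := by rw [hs, hK]; exact (Int.mul_ediv_add_emod _ _).symm
  -- the twelve quotients
  have q0 := natDiv_cast_eq hp (2 * K - 15 * N) (2 * s - 15 * r) (j0) (X := 2 * k - bT n 0)
    (by simp; omega) (by simp; linear_combination 2 * hk1 - 15 * hn) h0
  have q1 := natDiv_cast_eq hp (2 * K - 32 * N) (2 * s - 32 * r) (j1) (X := 2 * k - aT n 0)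
    (by simp; omega) (by simp; linear_combination 2 * hk1 - 32 * hn) h1
  have q2 := natDiv_cast_eq hp (17 * N) (17 * r) (j2) (X := aT n 0 - bT n 0)
    (by simp; omega) (by simp; linear_combination 17 * hn) h2
  have q3 := natDiv_cast_eq hp (K - 6 * N) (s - 6 * r) (j3) (X := k - bT n 1)
    (by simp; omega) (by simp; linear_combination hk1 - 6 * hn) h3
  have q4 := natDiv_cast_eq hp (K - 11 * N) (s - 11 * r) (j4) (X := k - aT n 1)
    (by simp; omega) (by simp; linear_combination hk1 - 11 * hn) h4
  have q5 := natDiv_cast_eq hp (5 * N) (5 * r) (j5) (X := aT n 1 - bT n 1)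
    (by simp; omega) (by simp; linear_combination 5 * hn) h5
  have q6 := natDiv_cast_eq hp (11 * N) (11 * r) (j6) (X := bT n 2 - aT n 2 - 1)
    (by simp; omega) (by simp; linear_combination 11 * hn) h6
  have q7 := natDiv_cast_eq hp (K - 13 * N) (s - 13 * r) (j7) (X := k - aT n 2)
    (by simp; omega) (by simp; linear_combination hk1 - 13 * hn) h7
  have q8 := natDiv_cast_eq hp (24 * N - K) (24 * r - s) (j8) (X := bT n 2 - 1 - k)
    (by simp; omega) (by simp; linear_combination 24 * hn - hk1) h8
  have q9 := natDiv_cast_eq hp (11 * N) (11 * r) (j6) (X := bT n 3 - aT n 3 - 1)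
    (by simp; omega) (by simp; linear_combination 11 * hn) h6
  have q10 := natDiv_cast_eq hp (K - 15 * N) (s - 15 * r) (j10) (X := k - aT n 3)
    (by simp; omega) (by simp; linear_combination hk1 - 15 * hn) h10
  have q11 := natDiv_cast_eq hp (26 * N - K) (26 * r - s) (j11) (X := bT n 3 - 1 - k)
    (by simp; omega) (by simp; linear_combination 26 * hn - hk1) h11
  -- natural-number subtractions are exact (first-digit carries are nonnegative)
  have sub0 : (aT n 0 - bT n 0).toNat / p + (2 * k - aT n 0).toNat / p ≤ (2 * k - bT n 0).toNat / p := by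
    have e : (2 * k - bT n 0).toNat = (aT n 0 - bT n 0).toNat + (2 * k - aT n 0).toNat := by simp; omega
    rw [e]; exact Nat.add_div_le_add_div _ _ _
  have sub1 : (aT n 1 - bT n 1).toNat / p + (k - aT n 1).toNat / p ≤ (k - bT n 1).toNat / p := by
    have e : (k - bT n 1).toNat = (aT n 1 - bT n 1).toNat + (k - aT n 1).toNat := by simp; omega
    rw [e]; exact Nat.add_div_le_add_div _ _ _
  have sub2 : (k - aT n 2).toNat / p + (bT n 2 - 1 - k).toNat / p ≤ (bT n 2 - aT n 2 - 1).toNat / p := by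
    have e : (bT n 2 - aT n 2 - 1).toNat = (k - aT n 2).toNat + (bT n 2 - 1 - k).toNat := by simp; omega
    rw [e]; exact Nat.add_div_le_add_div _ _ _
  have sub3 : (k - aT n 3).toNat / p + (bT n 3 - 1 - k).toNat / p ≤ (bT n 3 - aT n 3 - 1).toNat / p := by
    have e : (bT n 3 - aT n 3 - 1).toNat = (k - aT n 3).toNat + (bT n 3 - 1 - k).toNat := by simp; omega
    rw [e]; exact Nat.add_div_le_add_div _ _ _
  have c0 : (((2 * k - bT n 0).toNat / p - (aT n 0 - bT n 0).toNat / p - (2 * k - aT n 0).toNat / p : ℕ) : ℤ)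
      = ((2 * k - bT n 0).toNat / p : ℕ) - ((aT n 0 - bT n 0).toNat / p : ℕ) - ((2 * k - aT n 0).toNat / p : ℕ) := by
    omega
  have c1 : (((k - bT n 1).toNat / p - (aT n 1 - bT n 1).toNat / p - (k - aT n 1).toNat / p : ℕ) : ℤ)
      = ((k - bT n 1).toNat / p : ℕ) - ((aT n 1 - bT n 1).toNat / p : ℕ) - ((k - aT n 1).toNat / p : ℕ) := by
    omega
  have c2 : (((bT n 2 - aT n 2 - 1).toNat / p - (k - aT n 2).toNat / p - (bT n 2 - 1 - k).toNat / p : ℕ) : ℤ)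
      = ((bT n 2 - aT n 2 - 1).toNat / p : ℕ) - ((k - aT n 2).toNat / p : ℕ) - ((bT n 2 - 1 - k).toNat / p : ℕ) := by
    omega
  have c3 : (((bT n 3 - aT n 3 - 1).toNat / p - (k - aT n 3).toNat / p - (bT n 3 - 1 - k).toNat / p : ℕ) : ℤ)
      = ((bT n 3 - aT n 3 - 1).toNat / p : ℕ) - ((k - aT n 3).toNat / p : ℕ) - ((bT n 3 - 1 - k).toNat / p : ℕ) := by
    omega
  unfold digitAT
  rw [Nat.cast_add, Nat.cast_add, Nat.cast_add, c0, c1, c2, c3, q0, q1, q2, q3, q4, q5, q6, q7, q8, q9, q10, q11]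
  ring

/-- **Lemma 8 for `q̂` at the partner, one leaf**: if on `16n+1 ≤ k ≤ 24n+1` the digit count is `≥ e` for every
`k` — supplied as a function producing the count from the digit rule — then `p^e ∣ q̂_n`.  (Assembly lemma:
`pow_dvd_formQTZ` with the partner's range `[15n+1, 24n+2)`, where `2k ≥ â₀ ⇔ k ≥ 16n+1`.) -/
theorem pow_dvd_qhat {n p : ℕ} (hn : 1 ≤ n) (hp : p.Prime) {e : ℕ}
    (he : ∀ k : ℤ, 16 * (n : ℤ) + 1 ≤ k → k ≤ 24 * (n : ℤ) + 1 → (e : ℤ) ≤ (digitAT p (aT n) (bT n) k : ℤ)) :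
    (p : ℤ) ^ e ∣ qhatP15 n := by
  haveI : Fact p.Prime := ⟨hp⟩
  refine pow_dvd_formQTZ (admissibleT hn) fun k hk hk0 => ?_
  rw [(range_eq n).1, (range_eq n).2, mem_Ico] at hk
  simp only [aT_zero] at hk0
  exact_mod_cast he k (by omega) (by omega)

end Summit.KontsevichZagierPeriods.Zeta5Search.TwoTaleP15

end
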